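import Literature.Analysis.FluidPDE.AxisymNoSwirlLpDissipation
import Literature.Analysis.FluidPDE.AxisymNoSwirlScaleInvariantBounds
import Literature.Analysis.FluidPDE.NashInequalityWholeSpace
import Literature.Analysis.ODE.SingularBernoulliComparison
import Literature.Analysis.FunctionSpaces.SupBoundFromLpBounds
import HarnessLib

/-!
# Axisymmetric flows without swirl: Nash decay of `η = ω_θ/r`
# (Gallay–Šverák 2015, Lemma 5.2 = Feng–Šverák 2015, Lemma 3.8)

Analysis/FluidPDE proof file (theorems only; no definitions, no named facts).

> **Lemma 5.2 [FS].** For any initial data `η₀ ∈ L¹(ℝ³)`, the solution of (2.9)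
> (`∂ₜη + u·∇η = Δη + (2/r)∂ᵣη`) satisfies, for `1 ≤ p ≤ ∞`,
> `‖η(t)‖_{L^p(ℝ³)} ≤ C t^{−(3/2)(1−1/p)} ‖η₀‖_{L¹(ℝ³)}`, `0 < t ≤ T`.

(Th. Gallay, V. Šverák, *Remarks on the Cauchy problem for the axisymmetric Navier–Stokes equations*,
Confluentes Math. 7 (2015) = arXiv:1510.01036, §5, Lemma 5.2, arXiv p. 16 — "a classical method due
to Nash"; = H. Feng, V. Šverák, Arch. Ration. Mech. Anal. 215 (2015) = arXiv:1301.6317, Lemma 3.8,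
whose printed proof (p. 12) is followed here: the `L^p` energy identity with dissipation,
`−dE_p/dt ≥ ν(4(p−1)/p)∫|∇(η^{p/2})|²` (tree: `AxisymNoSwirlLpDissipation`), Nash's inequality
`∫|∇u|² ≥ M(∫|u|)^{−4/3}(∫u²)^{5/3}` (tree: `NashInequalityWholeSpace`, `M = K⁻²`), the iteration
`p = 2ⁿ → 2ⁿ⁺¹` through the integrated Bernoulli inequality (tree:
`le_mul_rpow_of_le_sub_intervalIntegral`, `SingularBernoulliComparison`), and `p → ∞` (tree:
`norm_le_of_lintegral_rpow_le_of_tendsto`, `SupBoundFromLpBounds`).)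

Everything is stated in Tao's smooth class (`IsTaoSolutionOn T ν u₀ v q`, viscosity `ν > 0`) for
solutions that are axisymmetric without swirl on `[0, T]` with `η(0) = angVortQuot (v 0) ∈ L¹(ℝ³)`;
`η(t) = angVortQuot (v t) = ω_θ/r`, `A = ∫ |η(0, x)| dx = ‖η₀‖_{L¹(ℝ³)} = 2π‖ω₀‖_{L¹(Ω)}`, and
`K₁ = max(K, 1)` with `K = SNormLESNormFDerivOfEqConst ℝ volume 2` Mathlib's Gagliardo–Nirenberg–Sobolev
constant (`n = 3`, `p = 2`), so that Nash's inequality holds with `K₁` (Feng–Šverák's `M = K₁⁻²`).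

* `IsTaoSolutionOn.integral_pow_two_mul_angVortQuot_le_of_integral_abs_pow_le` — **the iteration
  step `q = k → p = 2k`** (Feng–Šverák p. 12): if `∫ |η(τ)|^k ≤ B τ^{−(3/2)(k−1)}` on `(0, T]`, then
  `∫ η(t)^{2k} ≤ (3kK₁²/(4ν))^{3/2} B² t^{−(3/2)(2k−1)}` on `(0, T]` — the printed
  `C_p = (3p/(8M))^{3/(2p)} C_q` in the form `C_p^p = (3pK₁²/(8ν))^{3/2} (C_q^q)²`.
* `IsTaoSolutionOn.integral_abs_angVortQuot_pow_two_pow_le` — **`p = 2ⁿ`** (GS15 (5.6), FS (3.22) for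
  `p = 2ⁿ`): `∫ |η(t)|^{2ⁿ} dx ≤ (ab)^{2ⁿ−1} b^{−n} A^{2ⁿ} t^{−(3/2)(2ⁿ−1)}` for all `n`, `0 < t ≤ T`,
  with `a = (3K₁²/(4ν))^{3/2}`, `b = 2^{3/2}` — the exact solution `C(n) = (ab)^{2ⁿ−1} b^{−n}` of
  Feng–Šverák's recursion `C(n+1) = a bⁿ C(n)²`, `C(0) = 1`; i.e.
  `‖η(t)‖_{L^p} ≤ (ab)^{1−1/p} b^{−n/p} ‖η₀‖_{L¹} t^{−(3/2)(1−1/p)}` with `(ab)^{1−1/p} b^{−n/p} ≤ max(ab, 1)`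
  — Feng–Šverák's "`C_p` is uniformly bounded from above".
* `IsTaoSolutionOn.integral_sq_angVortQuot_le_nash` — **`p = 2`**:
  `∫ η(t)² dx ≤ (3K₁²/(4ν))^{3/2} ‖η₀‖²_{L¹} t^{−3/2}`.
* `IsTaoSolutionOn.abs_angVortQuot_le_nash` — **`p = ∞`** (GS15 (5.6)/(5.7) with `p = ∞`, the input of
  Prop. 5.3; FS (3.26)): `|η(t, x)| ≤ (3K₁²/(2ν))^{3/2} ‖η₀‖_{L¹} t^{−3/2}` for every `x`, and the
  vorticity form `…norm_curl_le_nash`: `|ω(t, x)| = r |η(t, x)| ≤ (3K₁²/(2ν))^{3/2} ‖η₀‖_{L¹} r t^{−3/2}`.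
* `…_of_datum` versions (axisymmetric swirl-free datum; the symmetry propagates,
  `IsTaoSolutionOn.isAxisymmetric`, `…hasNoSwirl`).

What is NOT here: intermediate `p` by interpolation; the `L¹(Ω)`/measure-valued data and the mild
formulation of the paper (§§3–4); Prop. 5.3 (the bound on `ω_θ` itself in `L^p(Ω)`, the tree's named
fact `GallaySverak2015.VorticitySupBound` for `p = ∞`), which needs the semigroup estimates of §3.

## Mathlib / tree search

Tree (all used): `AxisymNoSwirlLpDissipation` (`IsTaoSolutionOn.integral_pow_angVortQuot_add_norm_fderiv_pow_le`,
`…continuousOn_integral_pow_angVortQuot`, `…integrableOn_integral_norm_fderiv_pow_sq`,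
`…exists_forall_abs_angVortQuot_le`), `pow_five_integral_sq_le_nash` (`NashInequalityWholeSpace`),
`Literature.Analysis.ODE.le_mul_rpow_of_le_sub_intervalIntegral` (`SingularBernoulliComparison`),
`Literature.Analysis.FunctionSpaces.norm_le_of_lintegral_rpow_le_of_tendsto` (`SupBoundFromLpBounds`),
`IsTaoSolutionOn.lintegral_abs_angVortQuot_le` (`AxisymNoSwirlCoSignedFlux`, Lemma 5.1),
`exists_lintegral_sq_iteratedFDeriv_angVortQuot_le`, `memLp_two_of_norm_le_coe`,
`norm_curl_eq_cylRadius_mul_abs_angVortQuot`. `lean search 'NashDecay|t \^ \(-\(3 / 2|angVortQuot.*rpow'`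
(2026-08-27): no `L¹ → L^p` smoothing statement for `ω_θ/r` in the tree. Mathlib: `Real.rpow_*` algebra,
`intervalIntegral.integral_mono_on`, `ContinuousOn.intervalIntegrable`, `integral_eq_zero_iff_of_nonneg`,
`tendsto_pow_atTop_atTop_of_one_lt`, `Real.continuousAt_const_rpow`.

## References

* Th. Gallay, V. Šverák, *Remarks on the Cauchy problem for the axisymmetric Navier–Stokes
  equations*, Confluentes Math. 7 (2015) 67–92 = arXiv:1510.01036, §5 Lemma 5.2, (5.6)–(5.7)
  (arXiv p. 16). [GallaySverak2016]
* H. Feng, V. Šverák, *On the Cauchy problem for axi-symmetric vortex rings*, Arch. Ration. Mech.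
  Anal. 215 (2015) 89–123 = arXiv:1301.6317, Lemma 3.8 and its proof, Remark 3.9 (arXiv p. 12).
  [FengSverak2015]
* J. Nash, *Continuity of solutions of parabolic and elliptic equations*, Amer. J. Math. 80 (1958)
  931–954. [Nash1958]
-/

noncomputable section

open MeasureTheory Set Function Filter Topology InnerProductSpace WithLp
open scoped RealInnerProductSpace ContDiff ENNReal NNReal Topology
open Literature.Analysis.ODE Literature.Analysis.FunctionSpaces

namespace Literature.Analysis.FluidPDE

namespace AxisymNoSwirlNashDecay

/-! ### Private plumbing: Nash with `K₁ = max(K,1)`, slice data of the powers `η^k` -/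

/-- Nash's inequality on `ℝ³` with the constant `K₁ = max(K, 1) ≥ 1` in place of Mathlib's GNS
constant `K` (monotonicity in the constant). [cite: Nash1958, p. 936; FengSverak2015, proof of Lemma 3.8 (3.25)] -/
private theorem nash_max {u : EuclideanSpace ℝ (Fin 3) → ℝ} (hu : ContDiff ℝ 1 u) (h1 : Integrable u)
    (h2 : Integrable fun x => u x ^ 2) (hD : Integrable fun x => ‖fderiv ℝ u x‖ ^ 2) :
    (∫ x, u x ^ 2) ^ 5 ≤
      (max ((SNormLESNormFDerivOfEqConst ℝ (volume : Measure (EuclideanSpace ℝ (Fin 3))) 2 : ℝ)) 1) ^ 6 *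
        (∫ x, |u x|) ^ 4 * (∫ x, ‖fderiv ℝ u x‖ ^ 2) ^ 3 := by
  have h := pow_five_integral_sq_le_nash hu h1 h2 hD
  refine h.trans ?_
  have hA : 0 ≤ ∫ x, |u x| := integral_nonneg fun x => abs_nonneg _
  have hD0 : 0 ≤ ∫ x, ‖fderiv ℝ u x‖ ^ 2 := integral_nonneg fun x => sq_nonneg _
  have hK : ((SNormLESNormFDerivOfEqConst ℝ (volume : Measure (EuclideanSpace ℝ (Fin 3))) 2 : ℝ)) ^ 6 ≤
      (max ((SNormLESNormFDerivOfEqConst ℝ (volume : Measure (EuclideanSpace ℝ (Fin 3))) 2 : ℝ)) 1) ^ 6 :=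
    pow_le_pow_left₀ (NNReal.coe_nonneg _) (le_max_left _ _) 6
  exact mul_le_mul_of_nonneg_right (mul_le_mul_of_nonneg_right hK (pow_nonneg hA 4)) (pow_nonneg hD0 3)

/-- `‖D(G^k)(x)‖² = k² G(x)^{2k−2} ‖DG(x)‖²` for a differentiable scalar `G`, `k ≥ 1`. [folklore] -/
private theorem norm_fderiv_pow_sq' {G : EuclideanSpace ℝ (Fin 3) → ℝ} (hG : Differentiable ℝ G)
    {k : ℕ} (hk : 1 ≤ k) (x : EuclideanSpace ℝ (Fin 3)) :
    ‖fderiv ℝ (fun y => G y ^ k) x‖ ^ 2 = (k : ℝ) ^ 2 * G x ^ (2 * k - 2) * ‖fderiv ℝ G x‖ ^ 2 := by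
  have h1 : fderiv ℝ (fun y => G y ^ k) x = ((k : ℝ) * G x ^ (k - 1)) • fderiv ℝ G x := by
    rw [((hG x).hasFDerivAt.pow k).fderiv, nsmul_eq_mul]
  rw [h1, norm_smul, mul_pow, Real.norm_eq_abs, sq_abs, mul_pow, ← pow_mul,
    show (k - 1) * 2 = 2 * k - 2 by omega]

variable {T ν : ℝ} {u₀ : EuclideanSpace ℝ (Fin 3) → EuclideanSpace ℝ (Fin 3)}
  {v : ℝ → EuclideanSpace ℝ (Fin 3) → EuclideanSpace ℝ (Fin 3)} {q : ℝ → EuclideanSpace ℝ (Fin 3) → ℝ}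

/-- **`L¹` data of the slices** (Gallay–Šverák's Lemma 5.1 in the tree): if `η(0) ∈ L¹` then every
`η(τ)`, `τ ∈ [0, T]`, is integrable with `∫ |η(τ)| ≤ ∫ |η(0)|`. [cite: GallaySverak2016, §5 Lemma 5.1 (arXiv p. 16)] -/
private theorem integrable_slice (h : IsTaoSolutionOn T ν u₀ v q) (hT : 0 < T) (hν : 0 ≤ ν)
    (hax : ∀ t ∈ Icc 0 T, IsAxisymmetric (v t)) (hsw : ∀ t ∈ Icc 0 T, HasNoSwirl (v t))
    (hL1 : Integrable (angVortQuot (v 0))) {τ : ℝ} (hτ : τ ∈ Icc 0 T) :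
    Integrable (angVortQuot (v τ)) ∧
      (∫ x, |angVortQuot (v τ) x|) ≤ ∫ x, |angVortQuot (v 0) x| := by
  have hvs : ContDiff ℝ ∞ (v τ) := h.classical.contDiff_velocity hτ
  have hηc : Continuous (angVortQuot (v τ)) := (contDiff_angVortQuot_of_contDiff hvs).continuous
  have hlin := h.lintegral_abs_angVortQuot_le hT hν hax hsw (s := 0) (t := τ) ⟨le_rfl, hT.le⟩ hτ hτ.1
  have hfin : ∫⁻ x, ‖angVortQuot (v 0) x‖ₑ < ⊤ := hasFiniteIntegral_iff_enorm.1 hL1.hasFiniteIntegral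
  have hint : Integrable (angVortQuot (v τ)) :=
    ⟨hηc.aestronglyMeasurable, hasFiniteIntegral_iff_enorm.2 (hlin.trans_lt hfin)⟩
  refine ⟨hint, ?_⟩
  have e1 : ENNReal.ofReal (∫ x, |angVortQuot (v τ) x|) = ∫⁻ x, ‖angVortQuot (v τ) x‖ₑ := by
    rw [← ofReal_integral_norm_eq_lintegral_enorm hint]
    simp only [Real.norm_eq_abs]
  have e0 : ENNReal.ofReal (∫ x, |angVortQuot (v 0) x|) = ∫⁻ x, ‖angVortQuot (v 0) x‖ₑ := by
    rw [← ofReal_integral_norm_eq_lintegral_enorm hL1]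
    simp only [Real.norm_eq_abs]
  have hle : ENNReal.ofReal (∫ x, |angVortQuot (v τ) x|) ≤ ENNReal.ofReal (∫ x, |angVortQuot (v 0) x|) := by
    rw [e1, e0]; exact hlin
  exact (ENNReal.ofReal_le_ofReal_iff (integral_nonneg fun x => abs_nonneg _)).1 hle

/-- **Slice data of the powers `η^k`** (`k ≥ 1`, `τ ∈ [0, T]`, `η(0) ∈ L¹`): `η(τ)^k ∈ C¹`,
`η^k, (η^k)², |η|^k ∈ L¹`, `‖D(η^k)‖² ∈ L¹` (`η` is smooth, bounded on the slab, in `L¹ ∩ L²` with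
`∇η ∈ L²`). [folklore] -/
private theorem pow_slice_data (h : IsTaoSolutionOn T ν u₀ v q) (hT : 0 < T) (hν : 0 ≤ ν)
    (hax : ∀ t ∈ Icc 0 T, IsAxisymmetric (v t)) (hsw : ∀ t ∈ Icc 0 T, HasNoSwirl (v t))
    (hL1 : Integrable (angVortQuot (v 0))) {k : ℕ} (hk : 1 ≤ k) {τ : ℝ} (hτ : τ ∈ Icc 0 T) :
    ContDiff ℝ 1 (fun y => angVortQuot (v τ) y ^ k) ∧
      Integrable (fun x => angVortQuot (v τ) x ^ k) ∧
      Integrable (fun x => (angVortQuot (v τ) x ^ k) ^ 2) ∧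
      Integrable (fun x => ‖fderiv ℝ (fun y => angVortQuot (v τ) y ^ k) x‖ ^ 2) ∧
      Integrable (fun x => |angVortQuot (v τ) x| ^ k) := by
  have hvs : ∀ t ∈ Icc 0 T, ContDiff ℝ ∞ (v t) := fun t ht => h.classical.contDiff_velocity ht
  set η : EuclideanSpace ℝ (Fin 3) → ℝ := angVortQuot (v τ) with hη
  have hηs : ContDiff ℝ ∞ η := contDiff_angVortQuot_of_contDiff (hvs τ hτ)
  have hηc : Continuous η := hηs.continuous
  have hηd : Differentiable ℝ η := hηs.differentiable (by simp)
  obtain ⟨F, hF0, hF⟩ := h.exists_forall_abs_angVortQuot_le hax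
  have hFτ : ∀ x, |η x| ≤ F := hF τ hτ
  obtain ⟨hint, -⟩ := integrable_slice h hT hν hax hsw hL1 hτ
  -- `‖∇η‖² ∈ L¹`
  obtain ⟨C₁, hC₁⟩ := exists_lintegral_sq_iteratedFDeriv_angVortQuot_le hvs hax h.sobolev 1
  have hDm : MemLp (fun x => ‖fderiv ℝ η x‖) 2 volume :=
    memLp_two_of_norm_le_coe (F := fun x => iteratedFDeriv ℝ 1 η x)
      ((hηs.continuous_fderiv (by simp)).norm) (fun x => by
        rw [norm_norm, ← norm_iteratedFDeriv_zero (𝕜 := ℝ) (f := fderiv ℝ η), norm_iteratedFDeriv_fderiv])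
      (hC₁ τ hτ)
  have hD : Integrable (fun x => ‖fderiv ℝ η x‖ ^ 2) := hDm.integrable_sq
  -- pointwise bounds by `F`
  have hpow : ∀ (m : ℕ), 1 ≤ m → ∀ x, |η x| ^ m ≤ F ^ (m - 1) * |η x| := by
    intro m hm x
    obtain ⟨j, rfl⟩ : ∃ j, m = j + 1 := ⟨m - 1, by omega⟩
    rw [pow_succ, Nat.add_sub_cancel]
    exact mul_le_mul_of_nonneg_right (pow_le_pow_left₀ (abs_nonneg _) (hFτ x) j) (abs_nonneg _)
  have hdom : ∀ (m : ℕ), 1 ≤ m → Integrable (fun x => F ^ (m - 1) * |η x|) := fun m _ =>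
    hint.abs.const_mul _
  have hIabs : ∀ (m : ℕ), 1 ≤ m → Integrable (fun x => |η x| ^ m) := fun m hm =>
    (hdom m hm).mono' ((continuous_abs.comp hηc).pow m).aestronglyMeasurable
      (Eventually.of_forall fun x => by
        rw [Real.norm_eq_abs, abs_pow, abs_abs]; exact hpow m hm x)
  have hIpow : ∀ (m : ℕ), 1 ≤ m → Integrable (fun x => η x ^ m) := fun m hm =>
    (hdom m hm).mono' (hηc.pow m).aestronglyMeasurable
      (Eventually.of_forall fun x => by rw [Real.norm_eq_abs, abs_pow]; exact hpow m hm x)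
  refine ⟨(hηs.of_le (by norm_cast)).pow k, hIpow k hk, ?_, ?_, hIabs k hk⟩
  · have := hIpow (2 * k) (by omega)
    refine this.congr (Eventually.of_forall fun x => ?_)
    beta_reduce
    rw [← pow_mul, mul_comm]
  · refine ((hD.const_mul ((k : ℝ) ^ 2 * F ^ (2 * k - 2))).mono'
      ((((hηs.of_le (by norm_cast)).pow k).continuous_fderiv one_ne_zero).norm.pow 2).aestronglyMeasurable
      (Eventually.of_forall fun x => ?_))
    rw [Real.norm_eq_abs, abs_of_nonneg (sq_nonneg _), norm_fderiv_pow_sq' hηd hk x]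
    have h1 : η x ^ (2 * k - 2) ≤ F ^ (2 * k - 2) := by
      rw [← (show Even (2 * k - 2) from ⟨k - 1, by omega⟩).pow_abs]
      exact pow_le_pow_left₀ (abs_nonneg _) (hFτ x) _
    exact mul_le_mul_of_nonneg_right (mul_le_mul_of_nonneg_left h1 (sq_nonneg _)) (sq_nonneg _)

end AxisymNoSwirlNashDecay

open AxisymNoSwirlNashDecay

section NashIteration

variable {T ν : ℝ} {u₀ : EuclideanSpace ℝ (Fin 3) → EuclideanSpace ℝ (Fin 3)}
  {v : ℝ → EuclideanSpace ℝ (Fin 3) → EuclideanSpace ℝ (Fin 3)} {q : ℝ → EuclideanSpace ℝ (Fin 3) → ℝ}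

/-- **The Nash iteration step `q = k → p = 2k`** (Feng–Šverák, proof of Lemma 3.8). Let `(v, q)` be a
Tao-class solution of the unforced Navier–Stokes system on `[0, T] × ℝ³` with viscosity `ν > 0`,
axisymmetric without swirl at all times, with `η(0) = ω_θ(0)/r ∈ L¹(ℝ³)`; let `k ≥ 1`, `B ≥ 0`, and
suppose `∫ |η(τ)|^k dx ≤ B τ^{−(3/2)(k−1)}` for `τ ∈ (0, T]`. Then for `t ∈ (0, T]`

  `∫ η(t)^{2k} dx ≤ (3k K₁²/(4ν))^{3/2} B² t^{−(3/2)(2k−1)}`,  `K₁ = max(K_GNS, 1)`.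

Printed proof, followed verbatim: `E_p = ∫η^p`, `p = 2k`; the balance
`E_p(t) + ν(4(p−1)/p)∫ₛᵗ∫|∇η^{p/2}|² ≤ E_p(s)` (`…integral_pow_angVortQuot_add_norm_fderiv_pow_le`); Nash
`∫|∇η^{p/2}|² ≥ K₁⁻²(∫|η|^{p/2})^{−4/3}E_p^{5/3} ≥ K₁⁻²(Bτ^{−(3/2)(q−1)})^{−4/3}E_p^{5/3}`; hence
`E_p(t) ≤ E_p(s) − ∫ₛᵗ κτ^{p−2}E_p^{5/3}`, `κ = ν(4(p−1)/p)K₁⁻²B^{−4/3}`, and the integrated Bernoulli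
inequality (`le_mul_rpow_of_le_sub_intervalIntegral`, `γ = 2/3`, `m = p−2`) gives
`E_p(t) ≤ (3(p−1)/(2κ))^{3/2}t^{−(3/2)(p−1)} = (3pK₁²/(8ν))^{3/2}B²t^{−(3/2)(p−1)}` — the printed
`C_p = (3p/(8M))^{3/(2p)} C_q` with `M = K₁⁻²`, `B = C_q^q`, and the viscosity restored.
[cite: FengSverak2015, proof of Lemma 3.8 (arXiv:1301.6317 p. 12, the induction step (3.25)–(3.26)); GallaySverak2016, §5 Lemma 5.2 (arXiv p. 16)] -/
theorem IsTaoSolutionOn.integral_pow_two_mul_angVortQuot_le_of_integral_abs_pow_le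
    (h : IsTaoSolutionOn T ν u₀ v q) (hT : 0 < T) (hν : 0 < ν)
    (hax : ∀ t ∈ Icc 0 T, IsAxisymmetric (v t)) (hsw : ∀ t ∈ Icc 0 T, HasNoSwirl (v t))
    (hL1 : Integrable (angVortQuot (v 0))) {k : ℕ} (hk : 1 ≤ k) {B : ℝ} (hB : 0 ≤ B)
    (hyp : ∀ τ ∈ Ioc 0 T, ∫ x, |angVortQuot (v τ) x| ^ k ≤ B * τ ^ (-(3 / 2 : ℝ) * (k - 1)))
    {t : ℝ} (ht : t ∈ Ioc 0 T) :
    ∫ x, angVortQuot (v t) x ^ (2 * k) ≤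
      (3 * k * (max ((SNormLESNormFDerivOfEqConst ℝ (volume : Measure (EuclideanSpace ℝ (Fin 3))) 2 : ℝ)) 1)
        ^ 2 / (4 * ν)) ^ (3 / 2 : ℝ) * B ^ 2 * t ^ (-(3 / 2 : ℝ) * (2 * k - 1)) := by
  set K₁ : ℝ := max ((SNormLESNormFDerivOfEqConst ℝ (volume : Measure (EuclideanSpace ℝ (Fin 3))) 2 : ℝ)) 1
    with hK₁def
  have hK₁ : 1 ≤ K₁ := le_max_right _ _
  have hK₁0 : 0 < K₁ := one_pos.trans_le hK₁
  have htI : t ∈ Icc 0 T := ⟨ht.1.le, ht.2⟩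
  have hk1 : (1 : ℝ) ≤ k := by exact_mod_cast hk
  have hk0 : (0 : ℝ) < k := by linarith
  -- the functions `E_p`, `D_p` (`p = 2k`)
  set E : ℝ → ℝ := fun τ => ∫ x, angVortQuot (v τ) x ^ (2 * k) with hEdef
  set D : ℝ → ℝ := fun τ => ∫ x, ‖fderiv ℝ (fun y => angVortQuot (v τ) y ^ k) x‖ ^ 2 with hDdef
  have hE0 : ∀ τ, 0 ≤ E τ := fun τ => integral_nonneg fun x => (even_two_mul k).pow_nonneg _
  have hD0 : ∀ τ, 0 ≤ D τ := fun τ => integral_nonneg fun x => sq_nonneg _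
  show E t ≤ _
  -- the case `B = 0`: `η(t) = 0` a.e.
  rcases hB.eq_or_lt with hB0 | hBpos
  · obtain ⟨-, -, -, -, hIabs⟩ := pow_slice_data h hT hν.le hax hsw hL1 hk htI
    have hzero : ∫ x, |angVortQuot (v t) x| ^ k = 0 := by
      refine le_antisymm ?_ (integral_nonneg fun x => pow_nonneg (abs_nonneg _) _)
      have := hyp t ht
      rw [← hB0, zero_mul] at this
      exact this
    have hae : (fun x => |angVortQuot (v t) x| ^ k) =ᵐ[volume] 0 :=
      (integral_eq_zero_iff_of_nonneg (fun x => pow_nonneg (abs_nonneg _) _) hIabs).1 hzero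
    have hE : E t = 0 := by
      simp only [hEdef]
      refine integral_eq_zero_of_ae ?_
      filter_upwards [hae] with x hx
      have hx' : |angVortQuot (v t) x| ^ k = 0 := hx
      have h0 : angVortQuot (v t) x = 0 := by
        have := pow_eq_zero_iff (n := k) (by omega) |>.1 hx'
        exact abs_eq_zero.1 this
      simp [h0, zero_pow (by omega : 2 * k ≠ 0)]
    rw [hE, ← hB0]
    simp
  -- the case `B > 0`
  set c : ℝ := 2 * (2 * k - 1) / k with hcdef
  have hc0 : 0 < c := by rw [hcdef]; exact div_pos (by linarith) hk0
  set κ : ℝ := ν * c / (K₁ ^ 2 * B ^ (4 / 3 : ℝ)) with hκdef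
  have hB43 : 0 < B ^ (4 / 3 : ℝ) := Real.rpow_pos_of_pos hBpos _
  have hκ : 0 < κ := by
    rw [hκdef]; exact div_pos (mul_pos hν hc0) (mul_pos (pow_pos hK₁0 2) hB43)
  set m : ℝ := 2 * k - 2 with hmdef
  have hm : 0 ≤ m := by rw [hmdef]; linarith
  -- continuity of `E_p` and the balance
  have hEc : ContinuousOn E (Icc 0 T) := h.continuousOn_integral_pow_angVortQuot hT hax hk
  have hDint : IntegrableOn D (Ioo 0 T) := h.integrableOn_integral_norm_fderiv_pow_sq hT hax hk
  -- Nash at each slice: `κ τ^m E(τ)^{5/3} ≤ ν c D(τ)` on `(0, T]`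
  have hpt : ∀ τ ∈ Ioc 0 T, κ * τ ^ m * E τ ^ (1 + (2 / 3 : ℝ)) ≤ ν * c * D τ := by
    intro τ hτ
    have hτI : τ ∈ Icc 0 T := ⟨hτ.1.le, hτ.2⟩
    obtain ⟨hC1, hIk, hI2k, hDk, -⟩ := pow_slice_data h hT hν.le hax hsw hL1 hk hτI
    have hN := nash_max hC1 hIk hI2k hDk
    -- rewrite `∫ (η^k)² = E τ`, `∫ |η^k| = ∫ |η|^k ≤ B τ^{-a}`
    have e1 : ∫ x, (angVortQuot (v τ) x ^ k) ^ 2 = E τ := by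
      simp only [hEdef]
      refine integral_congr_ae (Eventually.of_forall fun x => ?_)
      beta_reduce
      rw [← pow_mul, mul_comm]
    have e2 : ∫ x, |angVortQuot (v τ) x ^ k| = ∫ x, |angVortQuot (v τ) x| ^ k := by
      refine integral_congr_ae (Eventually.of_forall fun x => ?_)
      beta_reduce
      rw [abs_pow]
    rw [e1, e2] at hN
    have hA0 : 0 ≤ ∫ x, |angVortQuot (v τ) x| ^ k := integral_nonneg fun x => pow_nonneg (abs_nonneg _) _
    set a : ℝ := (3 / 2 : ℝ) * (k - 1) with hadef
    have hτa : 0 < τ ^ (-a) := Real.rpow_pos_of_pos hτ.1 _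
    have hAB : (∫ x, |angVortQuot (v τ) x| ^ k) ≤ B * τ ^ (-a) := by
      have := hyp τ hτ
      rwa [show -(3 / 2 : ℝ) * (k - 1) = -a by rw [hadef]; ring] at this
    -- `E^5 ≤ K₁^6 (B τ^{-a})^4 D^3`
    have h5 : E τ ^ 5 ≤ K₁ ^ 6 * (B * τ ^ (-a)) ^ 4 * D τ ^ 3 := by
      refine hN.trans ?_
      have : (∫ x, |angVortQuot (v τ) x| ^ k) ^ 4 ≤ (B * τ ^ (-a)) ^ 4 := pow_le_pow_left₀ hA0 hAB 4
      have hK6 : 0 ≤ K₁ ^ 6 := pow_nonneg hK₁0.le 6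
      exact mul_le_mul_of_nonneg_right (mul_le_mul_of_nonneg_left this hK6) (pow_nonneg (hD0 τ) 3)
    -- cube roots
    have hX0 : 0 ≤ K₁ ^ 6 * (B * τ ^ (-a)) ^ 4 := mul_nonneg (pow_nonneg hK₁0.le 6) (pow_nonneg (by positivity) 4)
    have h53 : E τ ^ (1 + (2 / 3 : ℝ)) = (E τ ^ 5) ^ (1 / 3 : ℝ) := by
      rw [← Real.rpow_natCast (E τ) 5, ← Real.rpow_mul (hE0 τ)]
      norm_num
    have hroot : (E τ ^ 5) ^ (1 / 3 : ℝ) ≤ (K₁ ^ 6 * (B * τ ^ (-a)) ^ 4 * D τ ^ 3) ^ (1 / 3 : ℝ) :=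
      Real.rpow_le_rpow (pow_nonneg (hE0 τ) 5) h5 (by norm_num)
    have hrhs : (K₁ ^ 6 * (B * τ ^ (-a)) ^ 4 * D τ ^ 3) ^ (1 / 3 : ℝ) =
        K₁ ^ 2 * (B * τ ^ (-a)) ^ (4 / 3 : ℝ) * D τ := by
      rw [Real.mul_rpow hX0 (pow_nonneg (hD0 τ) 3),
        Real.mul_rpow (pow_nonneg hK₁0.le 6) (pow_nonneg (by positivity) 4)]
      have i1 : (K₁ ^ 6) ^ (1 / 3 : ℝ) = K₁ ^ 2 := by
        rw [← Real.rpow_natCast K₁ 6, ← Real.rpow_mul hK₁0.le, ← Real.rpow_natCast K₁ 2]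
        norm_num
      have i2 : ((B * τ ^ (-a)) ^ 4) ^ (1 / 3 : ℝ) = (B * τ ^ (-a)) ^ (4 / 3 : ℝ) := by
        rw [← Real.rpow_natCast (B * τ ^ (-a)) 4, ← Real.rpow_mul (by positivity)]
        norm_num
      have i3 : (D τ ^ 3) ^ (1 / 3 : ℝ) = D τ := by
        rw [one_div]
        exact Real.pow_rpow_inv_natCast (hD0 τ) three_ne_zero
      rw [i1, i2, i3]
    -- `(B τ^{-a})^{4/3} = B^{4/3} τ^{-m}`
    have hsplit : (B * τ ^ (-a)) ^ (4 / 3 : ℝ) = B ^ (4 / 3 : ℝ) * τ ^ (-m) := by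
      rw [Real.mul_rpow hB hτa.le, ← Real.rpow_mul hτ.1.le]
      congr 1
      congr 1
      rw [hadef, hmdef]
      ring
    have hE53 : E τ ^ (1 + (2 / 3 : ℝ)) ≤ K₁ ^ 2 * B ^ (4 / 3 : ℝ) * τ ^ (-m) * D τ := by
      rw [h53]
      refine hroot.trans_eq ?_
      rw [hrhs, hsplit]
      ring
    -- multiply by `κ τ^m`
    have hτm : 0 < τ ^ m := Real.rpow_pos_of_pos hτ.1 _
    have hmm : τ ^ m * τ ^ (-m) = 1 := by
      rw [Real.rpow_neg hτ.1.le, mul_inv_cancel₀ hτm.ne']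
    have hκK : κ * (K₁ ^ 2 * B ^ (4 / 3 : ℝ)) = ν * c := by
      rw [hκdef]
      exact div_mul_cancel₀ _ (mul_pos (pow_pos hK₁0 2) hB43).ne'
    calc κ * τ ^ m * E τ ^ (1 + (2 / 3 : ℝ))
        ≤ κ * τ ^ m * (K₁ ^ 2 * B ^ (4 / 3 : ℝ) * τ ^ (-m) * D τ) :=
          mul_le_mul_of_nonneg_left hE53 (mul_nonneg hκ.le hτm.le)
      _ = κ * (K₁ ^ 2 * B ^ (4 / 3 : ℝ)) * (τ ^ m * τ ^ (-m)) * D τ := by ring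
      _ = ν * c * D τ := by rw [hκK, hmm, mul_one]
  -- the integrated inequality
  have hineq : ∀ s t', 0 < s → s ≤ t' → t' ≤ T →
      E t' ≤ E s - ∫ τ in s..t', κ * τ ^ m * E τ ^ (1 + (2 / 3 : ℝ)) := by
    intro s t' hs hst ht'
    have hsI : s ∈ Icc 0 T := ⟨hs.le, hst.trans ht'⟩
    have ht'I : t' ∈ Icc 0 T := ⟨hs.le.trans hst, ht'⟩
    have hbal := h.integral_pow_angVortQuot_add_norm_fderiv_pow_le hT hν.le hax hsw hk hsI ht'I hst
    have hbal' : E t' + ν * c * ∫ τ in s..t', D τ ≤ E s := by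
      simpa only [hEdef, hDdef, hcdef] using hbal
    -- interval integrability of both sides on `[s, t']`
    have hsub : Icc s t' ⊆ Icc 0 T := Icc_subset_Icc hs.le ht'
    have hfi : IntervalIntegrable (fun τ => κ * τ ^ m * E τ ^ (1 + (2 / 3 : ℝ))) volume s t' := by
      refine ContinuousOn.intervalIntegrable ?_
      rw [uIcc_of_le hst]
      have c1 : ContinuousOn (fun τ : ℝ => τ ^ m) (Icc s t') :=
        continuousOn_id.rpow_const fun τ _ => Or.inr hm
      have c2 : ContinuousOn (fun τ => E τ ^ (1 + (2 / 3 : ℝ))) (Icc s t') :=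
        (hEc.mono hsub).rpow_const fun τ _ => Or.inr (by norm_num)
      exact (continuousOn_const.mul c1).mul c2
    have hgi : IntervalIntegrable (fun τ => ν * c * D τ) volume s t' := by
      rw [intervalIntegrable_iff_integrableOn_Ioo_of_le hst]
      exact (hDint.mono_set (Ioo_subset_Ioo hs.le ht')).const_mul _
    have hmono : ∫ τ in s..t', κ * τ ^ m * E τ ^ (1 + (2 / 3 : ℝ)) ≤ ∫ τ in s..t', ν * c * D τ :=
      intervalIntegral.integral_mono_on hst hfi hgi fun τ hτ =>
        hpt τ ⟨hs.trans_le hτ.1, hτ.2.trans ht'⟩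
    rw [intervalIntegral.integral_const_mul] at hmono
    linarith
  -- the Bernoulli comparison
  have hODE := le_mul_rpow_of_le_sub_intervalIntegral hκ hm (by norm_num : (0 : ℝ) < 2 / 3) hEc hineq t ht
  refine hODE.trans_eq ?_
  -- constants: `((m+1)/(κ·2/3))^{3/2} = (3kK₁²/(4ν))^{3/2} B²`, exponent `-(m+1)/(2/3) = -(3/2)(2k-1)`
  have hexp : -(m + 1) / (2 / 3 : ℝ) = -(3 / 2 : ℝ) * (2 * k - 1) := by
    rw [hmdef]; ring
  have hbase : (m + 1) / (κ * (2 / 3 : ℝ)) = 3 * k * K₁ ^ 2 / (4 * ν) * B ^ (4 / 3 : ℝ) := by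
    rw [hκdef, hmdef, hcdef]
    have h2k1 : (2 * (k : ℝ) - 1) ≠ 0 := by linarith
    have hνne : ν ≠ 0 := hν.ne'
    have hkne : (k : ℝ) ≠ 0 := hk0.ne'
    have hKne : K₁ ≠ 0 := hK₁0.ne'
    have hBne : B ^ (4 / 3 : ℝ) ≠ 0 := hB43.ne'
    field_simp
    ring
  have hpow : (3 * k * K₁ ^ 2 / (4 * ν) * B ^ (4 / 3 : ℝ)) ^ (1 / (2 / 3) : ℝ) =
      (3 * k * K₁ ^ 2 / (4 * ν)) ^ (3 / 2 : ℝ) * B ^ 2 := by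
    have h32 : (1 / (2 / 3) : ℝ) = 3 / 2 := by norm_num
    rw [h32, Real.mul_rpow (by positivity) hB43.le, ← Real.rpow_mul hB, ← Real.rpow_natCast B 2]
    norm_num
  rw [hexp, hbase, hpow]

/-- **Gallay–Šverák 2015, Lemma 5.2 / Feng–Šverák 2015, Lemma 3.8 for `p = 2ⁿ`.** Let `(v, q)` be a
Tao-class solution of the unforced Navier–Stokes system on `[0, T] × ℝ³` with viscosity `ν > 0`,
axisymmetric without swirl at all times, with `η(0) = ω_θ(0)/r ∈ L¹(ℝ³)`, `A = ∫|η(0)| dx`. Then for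
every `n` and `t ∈ (0, T]`:

  `∫ |η(t, x)|^{2ⁿ} dx ≤ (ab)^{2ⁿ−1} b^{−n} A^{2ⁿ} t^{−(3/2)(2ⁿ−1)}`,

`a = (3K₁²/(4ν))^{3/2}`, `b = 2^{3/2}`, `K₁ = max(K_GNS, 1)` — i.e.
`‖η(t)‖_{L^p} ≤ C_p ‖η₀‖_{L¹} t^{−(3/2)(1−1/p)}` with `C_p^p = (ab)^{p−1} b^{−n}`, the exact solution of
the printed recursion `C_p = (3p/(8M))^{3/(2p)} C_q` (`p = 2q`, `M = K₁⁻²`, `C_1 = 1` in units of `A`)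
starting from Lemma 5.1 (`∫|η(t)| ≤ A`, the tree's `IsTaoSolutionOn.lintegral_abs_angVortQuot_le`).
[cite: GallaySverak2016, §5 Lemma 5.2 (5.6) (arXiv p. 16); FengSverak2015, Lemma 3.8 (3.22) and its proof for p = 2ⁿ (arXiv p. 12)] -/
theorem IsTaoSolutionOn.integral_abs_angVortQuot_pow_two_pow_le
    (h : IsTaoSolutionOn T ν u₀ v q) (hT : 0 < T) (hν : 0 < ν)
    (hax : ∀ t ∈ Icc 0 T, IsAxisymmetric (v t)) (hsw : ∀ t ∈ Icc 0 T, HasNoSwirl (v t))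
    (hL1 : Integrable (angVortQuot (v 0))) (n : ℕ) {t : ℝ} (ht : t ∈ Ioc 0 T) :
    ∫ x, |angVortQuot (v t) x| ^ (2 ^ n) ≤
      ((3 * (max ((SNormLESNormFDerivOfEqConst ℝ (volume : Measure (EuclideanSpace ℝ (Fin 3))) 2 : ℝ)) 1)
          ^ 2 / (4 * ν)) ^ (3 / 2 : ℝ) * (2 : ℝ) ^ (3 / 2 : ℝ)) ^ (2 ^ n - 1) /
        ((2 : ℝ) ^ (3 / 2 : ℝ)) ^ n * (∫ x, |angVortQuot (v 0) x|) ^ (2 ^ n) *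
          t ^ (-(3 / 2 : ℝ) * (2 ^ n - 1)) := by
  set K₁ : ℝ := max ((SNormLESNormFDerivOfEqConst ℝ (volume : Measure (EuclideanSpace ℝ (Fin 3))) 2 : ℝ)) 1
    with hK₁def
  set a : ℝ := (3 * K₁ ^ 2 / (4 * ν)) ^ (3 / 2 : ℝ) with hadef
  set b : ℝ := (2 : ℝ) ^ (3 / 2 : ℝ) with hbdef
  set A : ℝ := ∫ x, |angVortQuot (v 0) x| with hAdef
  have hK₁0 : 0 < K₁ := one_pos.trans_le (le_max_right _ _)
  have ha0 : 0 < a := by rw [hadef]; exact Real.rpow_pos_of_pos (by positivity) _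
  have hb0 : 0 < b := by rw [hbdef]; exact Real.rpow_pos_of_pos two_pos _
  have hA0 : 0 ≤ A := integral_nonneg fun x => abs_nonneg _
  suffices H : ∀ n : ℕ, ∀ t ∈ Ioc 0 T, ∫ x, |angVortQuot (v t) x| ^ (2 ^ n) ≤
      (a * b) ^ (2 ^ n - 1) / b ^ n * A ^ (2 ^ n) * t ^ (-(3 / 2 : ℝ) * (2 ^ n - 1)) from H n t ht
  intro n
  induction n with
  | zero =>
    intro t ht
    have htI : t ∈ Icc 0 T := ⟨ht.1.le, ht.2⟩
    obtain ⟨-, hle⟩ := integrable_slice h hT hν.le hax hsw hL1 htI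
    simpa using hle
  | succ n ih =>
    intro t ht
    -- the step with `k = N = 2ⁿ`, `B = (ab)^{N-1} b^{-n} A^{N}`
    have hmainN := fun τ (hτ : τ ∈ Ioc 0 T) => ih τ hτ
    set N : ℕ := 2 ^ n with hNdef
    have hN1 : 1 ≤ N := Nat.one_le_two_pow
    set B : ℝ := (a * b) ^ (N - 1) / b ^ n * A ^ N with hBdef
    have hB : 0 ≤ B := by rw [hBdef]; positivity
    have hcast : ((2 : ℝ) ^ n) = (N : ℝ) := by simp [hNdef]
    have hypN : ∀ τ ∈ Ioc 0 T, ∫ x, |angVortQuot (v τ) x| ^ N ≤ B * τ ^ (-(3 / 2 : ℝ) * (N - 1)) := by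
      intro τ hτ
      have := hmainN τ hτ
      rw [hcast] at this
      simpa only [hBdef] using this
    have hstep := h.integral_pow_two_mul_angVortQuot_le_of_integral_abs_pow_le hT hν hax hsw hL1 hN1 hB
      hypN ht
    have e3 : 2 ^ (n + 1) - 1 = 2 * (N - 1) + 1 := by
      rw [pow_succ, ← hNdef]; omega
    have e4 : (2 : ℕ) ^ (n + 1) = 2 * N := by rw [pow_succ, ← hNdef]; ring
    have hNr : ((2 : ℝ) ^ (n + 1)) = 2 * (N : ℝ) := by rw [pow_succ, hcast]; ring
    -- `|η|^{2^{n+1}} = η^{2N}`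
    have hev : Even (2 * N) := even_two_mul N
    have e1 : ∫ x, |angVortQuot (v t) x| ^ (2 ^ (n + 1)) = ∫ x, angVortQuot (v t) x ^ (2 * N) := by
      refine integral_congr_ae (Eventually.of_forall fun x => ?_)
      beta_reduce
      rw [e4, hev.pow_abs]
    rw [e1]
    refine hstep.trans_eq ?_
    -- bookkeeping of the constants
    have e2 : (3 * (N : ℝ) * K₁ ^ 2 / (4 * ν)) ^ (3 / 2 : ℝ) = a * b ^ n := by
      have : 3 * (N : ℝ) * K₁ ^ 2 / (4 * ν) = 3 * K₁ ^ 2 / (4 * ν) * (N : ℝ) := by ring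
      rw [this, Real.mul_rpow (by positivity) (by positivity), hadef, hbdef]
      congr 1
      rw [hNdef, Nat.cast_pow, Nat.cast_ofNat, ← Real.rpow_natCast 2 n, ← Real.rpow_mul (by norm_num),
        mul_comm, Real.rpow_mul (by norm_num), Real.rpow_natCast]
    rw [e2, e3, e4, hNr, hBdef]
    have hbn : b ^ n ≠ 0 := pow_ne_zero _ hb0.ne'
    have hbne : b ≠ 0 := hb0.ne'
    field_simp
    ring

/-- **Lemma 5.2 for `p = 2`**: under the hypotheses of
`integral_abs_angVortQuot_pow_two_pow_le`, for `t ∈ (0, T]`,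
`∫ η(t, x)² dx ≤ (3K₁²/(4ν))^{3/2} (∫|η(0)| dx)² t^{−3/2}` (`‖η(t)‖_{L²} ≤ C ‖η₀‖_{L¹} t^{−3/4}`).
[cite: GallaySverak2016, §5 Lemma 5.2 (5.6) with p = 2 (arXiv p. 16); FengSverak2015, Lemma 3.8 proof, first step p = 2 (arXiv p. 12)] -/
theorem IsTaoSolutionOn.integral_sq_angVortQuot_le_nash (h : IsTaoSolutionOn T ν u₀ v q) (hT : 0 < T)
    (hν : 0 < ν) (hax : ∀ t ∈ Icc 0 T, IsAxisymmetric (v t)) (hsw : ∀ t ∈ Icc 0 T, HasNoSwirl (v t))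
    (hL1 : Integrable (angVortQuot (v 0))) {t : ℝ} (ht : t ∈ Ioc 0 T) :
    ∫ x, angVortQuot (v t) x ^ 2 ≤
      (3 * (max ((SNormLESNormFDerivOfEqConst ℝ (volume : Measure (EuclideanSpace ℝ (Fin 3))) 2 : ℝ)) 1)
        ^ 2 / (4 * ν)) ^ (3 / 2 : ℝ) * (∫ x, |angVortQuot (v 0) x|) ^ 2 * t ^ (-(3 / 2 : ℝ)) := by
  have hA0 : 0 ≤ ∫ x, |angVortQuot (v 0) x| := integral_nonneg fun x => abs_nonneg _
  have hyp : ∀ τ ∈ Ioc 0 T, ∫ x, |angVortQuot (v τ) x| ^ 1 ≤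
      (∫ x, |angVortQuot (v 0) x|) * τ ^ (-(3 / 2 : ℝ) * ((1 : ℕ) - 1)) := by
    intro τ hτ
    have := (integrable_slice h hT hν.le hax hsw hL1 ⟨hτ.1.le, hτ.2⟩).2
    simpa using this
  have := h.integral_pow_two_mul_angVortQuot_le_of_integral_abs_pow_le hT hν hax hsw hL1 (le_refl 1)
    hA0 hyp ht
  norm_num at this ⊢
  exact this

end NashIteration

section SupBound

variable {T ν : ℝ} {u₀ : EuclideanSpace ℝ (Fin 3) → EuclideanSpace ℝ (Fin 3)}
  {v : ℝ → EuclideanSpace ℝ (Fin 3) → EuclideanSpace ℝ (Fin 3)} {q : ℝ → EuclideanSpace ℝ (Fin 3) → ℝ}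

/-- **Gallay–Šverák 2015, Lemma 5.2 / Feng–Šverák 2015, Lemma 3.8 for `p = ∞`.** Let `(v, q)` be a
Tao-class solution of the unforced Navier–Stokes system on `[0, T] × ℝ³` with viscosity `ν > 0`,
axisymmetric without swirl at all times, with `η(0) = ω_θ(0)/r ∈ L¹(ℝ³)`. Then for `t ∈ (0, T]` and
every `x`:

  `|η(t, x)| ≤ (3K₁²/(2ν))^{3/2} (∫ |η(0)| dx) t^{−3/2}`,  `K₁ = max(K_GNS, 1)`

(`‖ω_θ(t)/r‖_{L^∞} ≤ C t^{−3/2} ‖ω₀/r‖_{L¹(ℝ³)}`). Proof: the `p = 2ⁿ` bounds give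
`∫|η(t)|^{p} ≤ t^{3/2}(ab)^{−1} · (ab A t^{−3/2})^{p}` (`b^{−n} ≤ 1`), and `p → ∞` for the continuous
slice `η(t)` (`norm_le_of_lintegral_rpow_le_of_tendsto` with `B_p = ab A t^{−3/2} (t^{3/2}/(ab))^{1/p} →
ab A t^{−3/2}`), `ab = (3K₁²/(2ν))^{3/2}` — Feng–Šverák's `C_∞`.
[cite: GallaySverak2016, §5 Lemma 5.2 (5.6)–(5.7) with p = ∞ (arXiv p. 16–17); FengSverak2015, Lemma 3.8 proof, `‖η(t)‖_{L^∞} ≤ C_∞ t^{−3/2}` and Remark 3.9 (arXiv p. 12)] -/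
theorem IsTaoSolutionOn.abs_angVortQuot_le_nash (h : IsTaoSolutionOn T ν u₀ v q) (hT : 0 < T)
    (hν : 0 < ν) (hax : ∀ t ∈ Icc 0 T, IsAxisymmetric (v t)) (hsw : ∀ t ∈ Icc 0 T, HasNoSwirl (v t))
    (hL1 : Integrable (angVortQuot (v 0))) {t : ℝ} (ht : t ∈ Ioc 0 T) (x : EuclideanSpace ℝ (Fin 3)) :
    |angVortQuot (v t) x| ≤
      (3 * (max ((SNormLESNormFDerivOfEqConst ℝ (volume : Measure (EuclideanSpace ℝ (Fin 3))) 2 : ℝ)) 1)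
        ^ 2 / (2 * ν)) ^ (3 / 2 : ℝ) * (∫ y, |angVortQuot (v 0) y|) * t ^ (-(3 / 2 : ℝ)) := by
  set K₁ : ℝ := max ((SNormLESNormFDerivOfEqConst ℝ (volume : Measure (EuclideanSpace ℝ (Fin 3))) 2 : ℝ)) 1
    with hK₁def
  set a : ℝ := (3 * K₁ ^ 2 / (4 * ν)) ^ (3 / 2 : ℝ) with hadef
  set b : ℝ := (2 : ℝ) ^ (3 / 2 : ℝ) with hbdef
  set A : ℝ := ∫ y, |angVortQuot (v 0) y| with hAdef
  have hK₁0 : 0 < K₁ := one_pos.trans_le (le_max_right _ _)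
  have ha0 : 0 < a := by rw [hadef]; exact Real.rpow_pos_of_pos (by positivity) _
  have hb0 : 0 < b := by rw [hbdef]; exact Real.rpow_pos_of_pos two_pos _
  have hb1 : 1 ≤ b := by
    rw [hbdef]; exact Real.one_le_rpow (by norm_num) (by norm_num)
  have hA0 : 0 ≤ A := integral_nonneg fun y => abs_nonneg _
  have htpos : 0 < t := ht.1
  have htI : t ∈ Icc 0 T := ⟨ht.1.le, ht.2⟩
  -- `ab = (3K₁²/(2ν))^{3/2}`
  have hab : a * b = (3 * K₁ ^ 2 / (2 * ν)) ^ (3 / 2 : ℝ) := by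
    rw [hadef, hbdef, ← Real.mul_rpow (by positivity) (by norm_num)]
    congr 1
    ring
  rw [← hab]
  -- the limit value `L` and the correction `c₀`
  set L : ℝ := a * b * A * t ^ (-(3 / 2 : ℝ)) with hLdef
  set c₀ : ℝ := t ^ (3 / 2 : ℝ) / (a * b) with hc₀def
  have hab0 : 0 < a * b := mul_pos ha0 hb0
  have hc₀ : 0 < c₀ := by rw [hc₀def]; exact div_pos (Real.rpow_pos_of_pos htpos _) hab0
  have hL0 : 0 ≤ L := by rw [hLdef]; exact mul_nonneg (mul_nonneg hab0.le hA0) (Real.rpow_nonneg htpos.le _)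
  show |angVortQuot (v t) x| ≤ L
  rw [← Real.norm_eq_abs]
  -- the slice is continuous
  have hηc : Continuous (angVortQuot (v t)) :=
    (contDiff_angVortQuot_of_contDiff (h.classical.contDiff_velocity htI)).continuous
  refine norm_le_of_lintegral_rpow_le_of_tendsto (μ := volume) hηc (p := fun n => ((2 ^ n : ℕ) : ℝ))
    (B := fun n => L * c₀ ^ (1 / ((2 ^ n : ℕ) : ℝ))) (L := L) (fun n => by positivity)
    ?_ (fun n => by positivity) ?_ ?_ x
  · -- `2ⁿ → ∞`
    have h1 : Tendsto (fun n : ℕ => (2 : ℝ) ^ n) atTop atTop := tendsto_pow_atTop_atTop_of_one_lt one_lt_two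
    refine h1.congr fun n => ?_
    simp
  · -- `B_n → L`
    have hp : Tendsto (fun n : ℕ => ((2 ^ n : ℕ) : ℝ)) atTop atTop := by
      have h1 : Tendsto (fun n : ℕ => (2 : ℝ) ^ n) atTop atTop :=
        tendsto_pow_atTop_atTop_of_one_lt one_lt_two
      refine h1.congr fun n => ?_
      simp
    have h1 : Tendsto (fun n : ℕ => 1 / ((2 ^ n : ℕ) : ℝ)) atTop (𝓝 0) := tendsto_const_nhds.div_atTop hp
    have h2 : Tendsto (fun n : ℕ => c₀ ^ (1 / ((2 ^ n : ℕ) : ℝ))) atTop (𝓝 (c₀ ^ (0 : ℝ))) :=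
      ((Real.continuousAt_const_rpow hc₀.ne').tendsto).comp h1
    rw [Real.rpow_zero] at h2
    simpa using h2.const_mul L
  · -- the bounds `∫⁻ |η(t)|^{2ⁿ} ≤ ofReal (B_n^{2ⁿ})`
    intro n
    show ∫⁻ y, ‖angVortQuot (v t) y‖ₑ ^ (((2 ^ n : ℕ) : ℝ)) ≤
      ENNReal.ofReal ((L * c₀ ^ (1 / ((2 ^ n : ℕ) : ℝ))) ^ ((2 ^ n : ℕ) : ℝ))
    have hmain := h.integral_abs_angVortQuot_pow_two_pow_le hT hν hax hsw hL1 n ht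
    obtain ⟨-, -, -, -, hIabs⟩ := pow_slice_data h hT hν.le hax hsw hL1 (Nat.one_le_two_pow (n := n)) htI
    have hcast : ((2 : ℝ) ^ n - 1) = ((2 ^ n - 1 : ℕ) : ℝ) := by
      rw [Nat.cast_sub Nat.one_le_two_pow, Nat.cast_one, Nat.cast_pow, Nat.cast_ofNat]
    rw [hcast] at hmain
    set N : ℕ := 2 ^ n with hNdef
    have hN1 : 1 ≤ N := Nat.one_le_two_pow
    have hN0 : N ≠ 0 := by omega
    -- real form of the left side
    have e1 : ∫⁻ y, ‖angVortQuot (v t) y‖ₑ ^ ((N : ℕ) : ℝ) =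
        ENNReal.ofReal (∫ y, |angVortQuot (v t) y| ^ N) := by
      rw [ofReal_integral_eq_lintegral_ofReal hIabs (Eventually.of_forall fun y =>
        pow_nonneg (abs_nonneg _) _)]
      refine lintegral_congr fun y => ?_
      rw [ENNReal.rpow_natCast, ← ofReal_norm, Real.norm_eq_abs, ← ENNReal.ofReal_pow (abs_nonneg _)]
    rw [e1]
    refine ENNReal.ofReal_le_ofReal ?_
    -- `B_n^{2ⁿ} = L^{N} c₀`
    have e2 : (L * c₀ ^ (1 / ((N : ℕ) : ℝ))) ^ ((N : ℕ) : ℝ) = L ^ N * c₀ := by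
      rw [Real.rpow_natCast, mul_pow, one_div, Real.rpow_inv_natCast_pow hc₀.le hN0]
    rw [e2]
    refine hmain.trans ?_
    -- drop `b^{-n} ≤ 1`
    have hbn : 1 ≤ b ^ n := one_le_pow₀ hb1
    have hw : (a * b) ^ (N - 1) / b ^ n * A ^ N * t ^ (-(3 / 2 : ℝ) * ((N - 1 : ℕ) : ℝ)) ≤
        (a * b) ^ (N - 1) * A ^ N * t ^ (-(3 / 2 : ℝ) * ((N - 1 : ℕ) : ℝ)) := by
      have h0 : 0 ≤ (a * b) ^ (N - 1) * A ^ N * t ^ (-(3 / 2 : ℝ) * ((N - 1 : ℕ) : ℝ)) := by positivity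
      rw [div_mul_eq_mul_div, div_mul_eq_mul_div]
      exact div_le_self h0 hbn
    refine hw.trans (le_of_eq ?_)
    -- `(ab)^{N-1} A^N t^{-(3/2)(N-1)} = L^N c₀`
    rw [hLdef, hc₀def]
    obtain ⟨j, hj⟩ : ∃ j, N = j + 1 := ⟨N - 1, by omega⟩
    rw [hj, Nat.add_sub_cancel]
    have hsne : t ^ (-(3 / 2 : ℝ)) ≠ 0 := (Real.rpow_pos_of_pos htpos _).ne'
    have hs : t ^ (3 / 2 : ℝ) = (t ^ (-(3 / 2 : ℝ)))⁻¹ := by rw [Real.rpow_neg htpos.le, inv_inv]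
    have ht32 : t ^ (-(3 / 2 : ℝ) * (j : ℕ)) = (t ^ (-(3 / 2 : ℝ))) ^ j := by
      rw [← Real.rpow_mul_natCast htpos.le]
    rw [ht32, hs]
    have habne : a * b ≠ 0 := hab0.ne'
    field_simp
    ring

/-- **The vorticity form** of the `p = ∞` bound: `|ω(t, x)| = r(x) |η(t, x)| ≤
(3K₁²/(2ν))^{3/2} (∫|η(0)|) r(x) t^{−3/2}` for `t ∈ (0, T]` — the swirl-free vorticity is
`ω = ω_θ e_θ` with `ω_θ = r η` (`norm_curl_eq_cylRadius_mul_abs_angVortQuot`).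
[cite: GallaySverak2016, §5 Lemma 5.2 (5.7) with p = ∞ (arXiv p. 16)] -/
theorem IsTaoSolutionOn.norm_curl_le_nash (h : IsTaoSolutionOn T ν u₀ v q)
    (hT : 0 < T) (hν : 0 < ν) (hax : ∀ t ∈ Icc 0 T, IsAxisymmetric (v t))
    (hsw : ∀ t ∈ Icc 0 T, HasNoSwirl (v t)) (hL1 : Integrable (angVortQuot (v 0))) {t : ℝ}
    (ht : t ∈ Ioc 0 T) (x : EuclideanSpace ℝ (Fin 3)) :
    ‖curl (v t) x‖ ≤
      (3 * (max ((SNormLESNormFDerivOfEqConst ℝ (volume : Measure (EuclideanSpace ℝ (Fin 3))) 2 : ℝ)) 1)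
        ^ 2 / (2 * ν)) ^ (3 / 2 : ℝ) * (∫ y, |angVortQuot (v 0) y|) * cylRadius x * t ^ (-(3 / 2 : ℝ)) := by
  have htI : t ∈ Icc 0 T := ⟨ht.1.le, ht.2⟩
  have hv3 : ContDiff ℝ 3 (v t) := (h.classical.contDiff_velocity htI).of_le (by norm_cast)
  rw [norm_curl_eq_cylRadius_mul_abs_angVortQuot (hax t htI) (hsw t htI) hv3 x]
  have hb := h.abs_angVortQuot_le_nash hT hν hax hsw hL1 ht x
  have hr : 0 ≤ cylRadius x := cylRadius_nonneg x
  calc cylRadius x * |angVortQuot (v t) x|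
      ≤ cylRadius x * ((3 * (max ((SNormLESNormFDerivOfEqConst ℝ
          (volume : Measure (EuclideanSpace ℝ (Fin 3))) 2 : ℝ)) 1) ^ 2 / (2 * ν)) ^ (3 / 2 : ℝ) *
          (∫ y, |angVortQuot (v 0) y|) * t ^ (-(3 / 2 : ℝ))) := mul_le_mul_of_nonneg_left hb hr
    _ = _ := by ring

end SupBound

/-! ### From an axisymmetric swirl-free datum -/

section Datum

variable {T ν : ℝ} {u₀ : EuclideanSpace ℝ (Fin 3) → EuclideanSpace ℝ (Fin 3)}
  {v : ℝ → EuclideanSpace ℝ (Fin 3) → EuclideanSpace ℝ (Fin 3)} {q : ℝ → EuclideanSpace ℝ (Fin 3) → ℝ}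

/-- **Lemma 5.2 (`p = 2ⁿ`) from the datum**: for a Tao-class solution on `[0, T]` (`ν > 0`) whose
datum `u₀` is axisymmetric without swirl with `ω_θ(0)/r ∈ L¹(ℝ³)`, the bounds of
`integral_abs_angVortQuot_pow_two_pow_le` hold. [cite: GallaySverak2016, §5 Lemma 5.2 (5.6) (arXiv p. 16); FengSverak2015, Lemma 3.8 (arXiv p. 12)] -/
theorem IsTaoSolutionOn.integral_abs_angVortQuot_pow_two_pow_le_of_datum
    (h : IsTaoSolutionOn T ν u₀ v q) (hT : 0 < T) (hν : 0 < ν) (h₀ : IsAxisymmetric u₀)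
    (h₀' : HasNoSwirl u₀) (hL1 : Integrable (angVortQuot u₀)) (n : ℕ) {t : ℝ} (ht : t ∈ Ioc 0 T) :
    ∫ x, |angVortQuot (v t) x| ^ (2 ^ n) ≤
      ((3 * (max ((SNormLESNormFDerivOfEqConst ℝ (volume : Measure (EuclideanSpace ℝ (Fin 3))) 2 : ℝ)) 1)
          ^ 2 / (4 * ν)) ^ (3 / 2 : ℝ) * (2 : ℝ) ^ (3 / 2 : ℝ)) ^ (2 ^ n - 1) /
        ((2 : ℝ) ^ (3 / 2 : ℝ)) ^ n * (∫ x, |angVortQuot u₀ x|) ^ (2 ^ n) *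
          t ^ (-(3 / 2 : ℝ) * (2 ^ n - 1)) := by
  have h0 : angVortQuot (v 0) = angVortQuot u₀ := by rw [h.initial]
  have hL1' : Integrable (angVortQuot (v 0)) := by rw [h0]; exact hL1
  have := h.integral_abs_angVortQuot_pow_two_pow_le hT hν (h.isAxisymmetric hν hT h₀)
    (h.hasNoSwirl hν hT h₀ h₀') hL1' n ht
  rwa [h0] at this

/-- **Lemma 5.2 (`p = ∞`) from the datum**: for a Tao-class solution on `[0, T]` (`ν > 0`) whose
datum `u₀` is axisymmetric without swirl with `η₀ = ω_θ(0)/r ∈ L¹(ℝ³)`, for `t ∈ (0, T]` and all `x`,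
`|η(t, x)| ≤ (3K₁²/(2ν))^{3/2} ‖η₀‖_{L¹} t^{−3/2}`.
[cite: GallaySverak2016, §5 Lemma 5.2 (5.6)–(5.7) with p = ∞ (arXiv p. 16); FengSverak2015, Lemma 3.8 and Remark 3.9 (arXiv p. 12)] -/
theorem IsTaoSolutionOn.abs_angVortQuot_le_nash_of_datum (h : IsTaoSolutionOn T ν u₀ v q) (hT : 0 < T)
    (hν : 0 < ν) (h₀ : IsAxisymmetric u₀) (h₀' : HasNoSwirl u₀) (hL1 : Integrable (angVortQuot u₀))
    {t : ℝ} (ht : t ∈ Ioc 0 T) (x : EuclideanSpace ℝ (Fin 3)) :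
    |angVortQuot (v t) x| ≤
      (3 * (max ((SNormLESNormFDerivOfEqConst ℝ (volume : Measure (EuclideanSpace ℝ (Fin 3))) 2 : ℝ)) 1)
        ^ 2 / (2 * ν)) ^ (3 / 2 : ℝ) * (∫ y, |angVortQuot u₀ y|) * t ^ (-(3 / 2 : ℝ)) := by
  have h0 : angVortQuot (v 0) = angVortQuot u₀ := by rw [h.initial]
  have hL1' : Integrable (angVortQuot (v 0)) := by rw [h0]; exact hL1
  have := h.abs_angVortQuot_le_nash hT hν (h.isAxisymmetric hν hT h₀) (h.hasNoSwirl hν hT h₀ h₀') hL1' ht x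
  rwa [h0] at this

end Datum

/-! ### Every `1 ≤ p < ∞` by interpolation between Lemma 5.1 (`p = 1`) and `p = ∞` -/

section Interpolation

variable {T ν : ℝ} {u₀ : EuclideanSpace ℝ (Fin 3) → EuclideanSpace ℝ (Fin 3)}
  {v : ℝ → EuclideanSpace ℝ (Fin 3) → EuclideanSpace ℝ (Fin 3)} {q : ℝ → EuclideanSpace ℝ (Fin 3) → ℝ}

/-- **Gallay–Šverák 2015, Lemma 5.2 for every real `1 ≤ p < ∞`** ("For other `p`, we can prove (3.22)
by interpolation", Feng–Šverák). Let `(v, q)` be a Tao-class solution of the unforced Navier–Stokes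
system on `[0, T] × ℝ³` with `ν > 0`, axisymmetric without swirl at all times, `η(0) ∈ L¹(ℝ³)`,
`A = ∫|η(0)| dx`, `C = (3K₁²/(2ν))^{3/2}`. Then for `t ∈ (0, T]`:

  `∫ |η(t, x)|^p dx ≤ (C A t^{−3/2})^{p−1} A`,  i.e. `‖η(t)‖_{L^p} ≤ C^{1−1/p} A t^{−(3/2)(1−1/p)}`

(`|η|^p = |η|^{p−1}|η| ≤ ‖η(t)‖_∞^{p−1}|η|`, the `p = ∞` bound `…abs_angVortQuot_le_nash` and Lemma 5.1
`∫|η(t)| ≤ A`). [cite: GallaySverak2016, §5 Lemma 5.2 (5.6), 1 ≤ p ≤ ∞ (arXiv p. 16); FengSverak2015, Lemma 3.8, last sentence of the proof (arXiv p. 12)] -/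
theorem IsTaoSolutionOn.integral_abs_angVortQuot_rpow_le_nash (h : IsTaoSolutionOn T ν u₀ v q)
    (hT : 0 < T) (hν : 0 < ν) (hax : ∀ t ∈ Icc 0 T, IsAxisymmetric (v t))
    (hsw : ∀ t ∈ Icc 0 T, HasNoSwirl (v t)) (hL1 : Integrable (angVortQuot (v 0)))
    {p : ℝ} (hp : 1 ≤ p) {t : ℝ} (ht : t ∈ Ioc 0 T) :
    ∫ x, |angVortQuot (v t) x| ^ p ≤
      ((3 * (max ((SNormLESNormFDerivOfEqConst ℝ (volume : Measure (EuclideanSpace ℝ (Fin 3))) 2 : ℝ)) 1)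
          ^ 2 / (2 * ν)) ^ (3 / 2 : ℝ) * (∫ y, |angVortQuot (v 0) y|) * t ^ (-(3 / 2 : ℝ))) ^ (p - 1) *
        ∫ y, |angVortQuot (v 0) y| := by
  set L : ℝ := (3 * (max ((SNormLESNormFDerivOfEqConst ℝ (volume : Measure (EuclideanSpace ℝ (Fin 3))) 2
    : ℝ)) 1) ^ 2 / (2 * ν)) ^ (3 / 2 : ℝ) * (∫ y, |angVortQuot (v 0) y|) * t ^ (-(3 / 2 : ℝ)) with hLdef
  have htI : t ∈ Icc 0 T := ⟨ht.1.le, ht.2⟩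
  have hL : ∀ x, |angVortQuot (v t) x| ≤ L := fun x => h.abs_angVortQuot_le_nash hT hν hax hsw hL1 ht x
  have hL0 : 0 ≤ L := (abs_nonneg _).trans (hL 0)
  obtain ⟨hint, hA⟩ := integrable_slice h hT hν.le hax hsw hL1 htI
  have hp1 : 0 ≤ p - 1 := by linarith
  -- pointwise `|η|^p ≤ L^{p-1} |η|`
  have hpt : ∀ x, |angVortQuot (v t) x| ^ p ≤ L ^ (p - 1) * |angVortQuot (v t) x| := by
    intro x
    have e : |angVortQuot (v t) x| ^ p = |angVortQuot (v t) x| ^ (p - 1) * |angVortQuot (v t) x| := by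
      conv_lhs => rw [show p = (p - 1) + 1 by ring]
      rw [Real.rpow_add' (abs_nonneg _) (by linarith : (p - 1) + 1 ≠ 0), Real.rpow_one]
    rw [e]
    exact mul_le_mul_of_nonneg_right (Real.rpow_le_rpow (abs_nonneg _) (hL x) hp1) (abs_nonneg _)
  calc ∫ x, |angVortQuot (v t) x| ^ p ≤ ∫ x, L ^ (p - 1) * |angVortQuot (v t) x| :=
        integral_mono_of_nonneg (Eventually.of_forall fun x => Real.rpow_nonneg (abs_nonneg _) _)
          (hint.abs.const_mul _) (Eventually.of_forall hpt)
    _ = L ^ (p - 1) * ∫ x, |angVortQuot (v t) x| := integral_const_mul _ _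
    _ ≤ L ^ (p - 1) * ∫ y, |angVortQuot (v 0) y| :=
        mul_le_mul_of_nonneg_left hA (Real.rpow_nonneg hL0 _)

/-- **Lemma 5.2 for every real `1 ≤ p < ∞`, from the datum** (axisymmetric swirl-free `u₀` with
`ω_θ(0)/r ∈ L¹`). [cite: GallaySverak2016, §5 Lemma 5.2 (5.6), 1 ≤ p ≤ ∞ (arXiv p. 16); FengSverak2015, Lemma 3.8 (arXiv p. 12)] -/
theorem IsTaoSolutionOn.integral_abs_angVortQuot_rpow_le_nash_of_datum (h : IsTaoSolutionOn T ν u₀ v q)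
    (hT : 0 < T) (hν : 0 < ν) (h₀ : IsAxisymmetric u₀) (h₀' : HasNoSwirl u₀)
    (hL1 : Integrable (angVortQuot u₀)) {p : ℝ} (hp : 1 ≤ p) {t : ℝ} (ht : t ∈ Ioc 0 T) :
    ∫ x, |angVortQuot (v t) x| ^ p ≤
      ((3 * (max ((SNormLESNormFDerivOfEqConst ℝ (volume : Measure (EuclideanSpace ℝ (Fin 3))) 2 : ℝ)) 1)
          ^ 2 / (2 * ν)) ^ (3 / 2 : ℝ) * (∫ y, |angVortQuot u₀ y|) * t ^ (-(3 / 2 : ℝ))) ^ (p - 1) *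
        ∫ y, |angVortQuot u₀ y| := by
  have h0 : angVortQuot (v 0) = angVortQuot u₀ := by rw [h.initial]
  have hL1' : Integrable (angVortQuot (v 0)) := by rw [h0]; exact hL1
  have := h.integral_abs_angVortQuot_rpow_le_nash hT hν (h.isAxisymmetric hν hT h₀)
    (h.hasNoSwirl hν hT h₀ h₀') hL1' hp ht
  rwa [h0] at this

end Interpolation

end Literature.Analysis.FluidPDE
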